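import Literature.NumberTheory.EllipticCurves.PAdicBSD
import Literature.NumberTheory.EllipticCurves.PAdicLFunctionIntegralityAtTwoProofs
import Literature.Barriers.BirchSwinnertonDyer.ExceptionalZero
import HarnessLib

/-!
# The Greenberg–Stevens fact `greenberg_stevens` at `p = 2`: SCOPE OF RECORD (re-cite carrier) and the `p = 2` displays

A ZERO-CONE companion of `Literature.NumberTheory.EllipticCurves.PAdicBSD` (theorems only: no
definition, no named fact, nothing asserted; D-0014/D-0026). It exists for ONE reason, recorded
here so that nobody mistakes it for new mathematics: the docstring of the named fact
`Literature.NumberTheory.EllipticCurves.greenberg_stevens` (bsd.S24, the Mazur–Tate–Teitelbaum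
first-derivative formula in analytic rank `0` at a split multiplicative prime `p`) still says, in
its "Generality flag", that at `p = 2` NO print has been located. That sentence is now STALE: the
cell bsd-2adic (seats `bsd-2adic-mult-gs-a`, `-b`, `-c`, PROGRAMME v1 T5, 2026-08-26/27) located
statement-inclusive refereed print at every prime, and the referee desk ruled (pub-bsdpct
`REFEREE.md`, ROUND 384 and **ROUND 405 (2026-08-27): "hGS at `p = 2` = PRINT (dual chain,
audited at 2)"**). The in-place docstring re-cite of `PAdicBSD.lean` (cell file
`HOME/mult-gs-b/recite-v3-final.diff`, sha16 `99c88a02d48d4ff4`, endorsed AS IS by ROUND 405 R-6;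
statement unchanged) rebuilds a reverse cone of ≈ 17 000 modules and was therefore DEFERRED by the
cell's director (bsd-2adic INBOX 2026-08-27T01:22:41Z) to the next unavoidable edit of that file;
until then THIS module — which imports `PAdicBSD` and is imported by nothing — carries the record,
together with three small `p = 2` displays of the fact that are proved from the tree (§B).

## A. SCOPE OF RECORD for `greenberg_stevens W p` at every prime `p`, in particular `p = 2`
(text = the endorsed re-cite, lightly condensed; every locus was read first-hand by the cell and
re-found by the desk; "HOME" = the bsd-2adic cell folder `run/shared/lean/pub/bsd-2adic/`).

VERBATIM print at every ODD `p`: for `p ≥ 5` Greenberg–Stevens, Invent. Math. 111 (1993),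
Introduction Thm. (0.3) (p. 407) = Thm. 7.1 (p. 444), specialised to `f = f_E` through their
(3.6)/(3.11)/(3.17) (their `p ≥ 5` enters only through their Thm. 2.6 = Hida 1986 + Wiles 1988;
those INPUTS are printed for every `p` including `2` — `𝐩 = 4`, `Λ = W[[1+4ℤ₂]]`, `γ = 1 + 𝐩 = 5` —
in H. Hida, *Elementary Modular Iwasawa Theory* (World Scientific, 2022), ch. 4, Thms. 4.1.24,
4.2.17, 4.2.37, 4.2.47, but Greenberg–Stevens' §§5–7 are not re-run at `2` under that name); for
every odd `p` (so also `p = 3`) Kobayashi, Doc. Math. Extra Vol. Coates (2006), Cor. 4.2 (p. 575).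

AT EVERY PRIME `p`, IN PARTICULAR `p = 2` (print located, statement-inclusive, refereed ×3 —
pub-bsdpct ROUND 384; proof-chain word at `p = 2`: referee C ROUND 405: PRINT (dual chain, audited
at 2) — primary (B), corroborating (C); (A) ranked below): two REFEREED chains whose statements
carry no hypothesis on `p` give the identity at their instance `F = ℚ`, `π = π_E` Steinberg at `p`.

(B) D. Barrera Salazar, M. Dimitrov, A. Jorza, *`p`-adic `L`-functions of Hilbert cusp forms and
the trivial zero conjecture*, J. Eur. Math. Soc. 24 (2022) 3439–3503, Thm. 7.1 (p. 3495) with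
Def. 5.3 (p. 3490) and Prop. 5.2, for `(k,w) = (2,0)`, `e = 1`:
`L_p'(π̃_E, 1) = 𝓛_FM(V_pE) · L(E,1)/Ω_{π̃_E}` — the Greenberg–Stevens functional-equation /
improved-`L`-function argument run on the slope-`0` component of the cuspidal eigenvariety (their
Thm. 2.14), the cyclotomic variable being `⟨·⟩_p = χ_cyc ω_p⁻¹` with `ω_p` the Teichmüller character
mod `4` at `p = 2` (p. 3444), i.e. `γ = cyclotomicGenerator 2 = 5`; `𝓛_FM` is Fontaine's invariant
(normalisation of Y. Zhang, Sci. China Math. 57 (2014) §4; the display of their §5.2 transposes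
`e₁, e₂` — a harmless misprint, ROUND 405 R-2), which for the Tate curve is `log_p q_E / ord_p q_E`
(Colmez, Astérisque 294 (2004) exp. 919, p. 255 and fn. 96 p. 306; Berger, *An introduction to the
theory of `p`-adic representations* (2004) §II.4). Cell D-audit
`HOME/audit/D-AUDIT-hGS-BDJ22-Thm71-HidaFamily-chain-at-2.md` with ADDENDA 1–2 (every input located
parity-free; the family input Kisin, Invent. Math. 153 (2003) §5 — Prop. 5.4, Cor. 5.16 — is a
local `G_{ℚ_p}` statement whose proof treats `p = 2` explicitly, §4 (4.5.2)).
[cite: BarreraDimitrovJorza2022, Thm. 7.1 + Def. 5.3 + Prop. 5.2 (F = ℚ, (k,w) = (2,0), π_p = St; any prime p; p = 2 convention p. 3444)]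

(C) M. Spieß, Invent. Math. 196 (2014) 69–138, Thm. 6.7 (= arXiv Thm. 5.7:
`L_p^{(r)}(0,π) = r! ∏_{S₁} 𝓛_𝔭(π) ∏_{S₂} e(α_𝔭,1) · L(½,π)`, any totally real `F`, any `p`) with
L. Gehrmann, G. Rosso, Compositio Math. 158 (2022) 409–436, Thm. 4.1 (iii)
(`𝓛(π,𝔭) = 𝓛^FM(ρ_{π,𝔭})`; Introduction: "one can remove the assumptions in the main theorem of
[Sp]") and `𝓛^FM` of the Tate curve `= log_p q_E/ord_p q_E` by Kummer theory; inputs located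
parity-free incl. Kohlhaase, J. reine angew. Math. 651 (2011) and Kohlhaase–Schraen, Math. Ann.
353 (2012). Cell D-audit `HOME/audit/D-AUDIT-hGS-Sp14-GR22-strongEZ-chain-at-2.md` with ADDENDA
1–4. The weak form (vanishing order only) is the named fact
`Literature.NumberTheory.EllipticCurves.Spiess2014.thm57_weakExceptionalZero_splitMultiplicative_rat`
(file `Spiess2014/WeakExceptionalZero.lean`), implied by `greenberg_stevens`
(`…_of_greenberg_stevens` there); ROUND 405 R-4: PASS, verbatim refereed print, flag-free.
[cite: Spiess2014Invent, Thm. 6.7 (= arXiv Thm. 5.7)] [cite: GehrmannRosso2022, Thm. 4.1 (iii) + Introduction]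

(A) On the Coleman-map (Kato–Kurihara–Tsuji / Colmez) road: Colmez, Sém. Bourbaki 919,
Astérisque 294 (2004), Thm. 0.11 (p. 255) = Thm. 4.16 (`k = 2`, `i = 0`, p. 306; proof pp. 307–308)
is stated and proved with no hypothesis on `p`, all inputs printed with explicit `p = 2` clauses
(Cherbonnier–Colmez 1999, Colmez 1998, Berger 2002, Kato 2004 §§12, 16); it is not cited flag-free
at `p = 2` only because of the author's footnote 8 (p. 254, self-scoped "au niveau de ce qui est
connu": the credited sources Greenberg–Stevens `p ≥ 5` / Kato–Kurihara–Tsuji unpublished) and the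
exposé genre (p. 271) — ROUND 405 R-5: PASS-AS-EXPOSÉ-PROOF; on that road the single step lacking
a refereed research-article proof at `p = 2` is the LOCAL DERIVATIVE LEMMA (Colmez Prop. 4.17 =
Kobayashi 2006 Thm. 4.1 = Benois, J. Inst. Math. Jussieu 13 (2014) = Colmez, Astérisque 330 (2010)
Prop. VI.1 under "p ≥ 3", fn. 1 "L'extension à p = 2 ne devrait pas poser de problèmes autres que
rédactionnels"); Perrin-Riou's crystalline theory (Invent. Math. 115 (1994), p. 81, l. 1: "Soit p
un nombre premier impair") is odd-standing. Disegni, Kyoto J. Math. 60 (2020), Thm. 1 with Prop. 2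
STATES the `p = 2`, rank-`0`, split-multiplicative case without hypothesis on `p` (ROUND 405 R-5:
PASS-AS-STATEMENT) and proves it (§3.2.1) by reference to Kobayashi 2006 together with the `p = 2`
Coleman-power-series interpolation theorems of Kobayashi, Invent. 191 (2013) Thm. 3.15 and Ota,
Tohoku Math. J. 66 (2014) Thm. 4.6 (2), which print the `p = 2` interpolation technique for OTHER
formal groups / towers. For Kobayashi's own tower at `p = 2` — the cyclotomic `ℤ₂`-extension
`ℚ_{2,∞} = ⋃ ℚ₂(ζ_{2^{n+2}} + ζ_{2^{n+2}}⁻¹)` of `ℚ₂`, `Δ = Gal(ℚ₂(μ_{2^∞})/ℚ_{2,∞}) = {±1}` (so his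
§2 device "`ζ_p − 1 ∉ 𝔪_n` ⇒ no `p`-power torsion" fails: `−1` is a principal unit) — the `Ĝ_m`
side of his §2 IS in refereed print (bsd-2adic seat mult-gs-a, 2026-08-27): `lim_n U¹(ℚ_{2,n})` is
free of rank one over `ℤ₂[[Γ]]` (Gillard, Ann. Inst. Fourier 29 no. 4 (1979), Prop. 1 and §2.2, any
`ℓ`, "`q = 4` si `ℓ = 2`"; quoted at `2` by T. Tsuji, J. Théor. Nombres Bordeaux 36 (2024), p. 462),
Coleman's exact sequence `0 → ℤ_p(1) → U_∞ → ℤ_p[[ℤ_p^×]] → ℤ_p(1) → 0` for `Ĝ_m` over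
`ℚ_p(μ_{p^∞})` is written out and proved at `p = 2` with the `{±1}`-torsion (Greither, Ann. Inst.
Fourier 42 (1992), Thm. 2.4 "For `p = 2`, replace the terms `ℤ_p(1)` by `(ℤ₂(1) × {1,−1})`",
Thm. 2.8, Prop. 2.10; Coleman, Proc. AMS 89 (1983), Thm. 4 itself has "(if `p ≠ 2`). (Again there
is a similar statement when `p = 2`.)"), the `{±1}`-descent of Coleman's homomorphism to the
`ℤ₂`-tower is T. Tsuji 2024, Thm. 4.1 and pp. 460–463 ("Since `U^{ω⁰} = U^{G₀} = U_{ℚ_{2,∞}}`, we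
have an isomorphism `Ψ_* : U^{ω⁰} ≅ (ℤ₂[[G_∞]])^{ω⁰}`", `Ĥ⁰(G₀, U) = μ₂`), and the `Λ`-valued
Hilbert-symbol pairing is computed by Coleman's reciprocity law at `ℓ = 2` in Flach, J. reine
angew. Math. 661 (2011), pp. 6–8 ("Coleman's reciprocity law … includes the case `l = 2`"). What
is NOT in print at `2` on this road is the DERIVATIVE content — Kobayashi's Prop. 2.2 (the
valuation of the Hilbert-90 element, "`p ≡ e_n(p−1) log_p κ(γ) mod p^{n+1}`") and Thm. 4.1 — which
the cell holds as a memo (`HOME/mult/PROOF-GS2.md`, cell referee RC-4 PASS). Cell files: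
`HOME/audit/D-AUDIT-hGS-roadA-Di20-Co04-ColemanMap-at-2.md`, `HOME/mult-gs-a/VERDICT.md` with
ADDENDA 1–5. The Breuil–Emerton road gives the weak form at every `p` (Emerton, Duke Math. J. 130
(2005) Cor. 5.7) and imports the identification of `𝓛`.
[cite: Kobayashi2006DocMath, Cor. 4.2 (p. 575); §2 Props. 2.1–2.2 (pp. 569–570)]
[cite: Colmez2004Bourbaki919, Thm. 0.11 (p. 255) = Thm. 4.16 (p. 306), Prop. 4.17, fn. 8 (p. 254)]
[cite: Disegni2020, Thm. 1, Prop. 2, §3.2.1] [cite: Greither1992AIF, Thm. 2.4, Thm. 2.8, Prop. 2.10 (pp. 459–462)]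
[cite: TsujiTakae2024JTNB, Thm. 4.1 (p. 455), pp. 460–463] [cite: Gillard1979UnitesII, Prop. 1 (p. 4), §2.2 (p. 5)]
[cite: Coleman1983LocalUnits, Thm. 4] [cite: Flach2011Crelle, pp. 6–8, Prop. 2.2]

No source prints a sentence working the case `p = 2` of the FORMULA by hand (the computational
literature states it for "p prime" and computes `𝓛 = -2 dlog a_p(κ)` at `p = 2`:
Anni–Böckle–Gräf–Troya, J. Théor. Nombres Bordeaux 31 (2019) pp. 728–731; Gräf, Ramanujan J. 50
(2019) §5.2); every tree consumer of `greenberg_stevens (p := 2)` takes it as a hypothesis,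
packaged on the Summits side as a conjecture leaf (bsd-2adic blocker B-ii, resolved per class in
certificate currency by the κ₁-valuation doors). The desk's ruling moves a CITATION TIER, not a
partition cell: `greenberg_stevens` stays a named fact (nothing is asserted anywhere), BSD is not
touched, and cells move only when proofs land.

## B. What this file PROVES (three displays of the fact at `p = 2`; all by unfolding and the tree)

* `greenberg_stevens_two_iff` — the fact at `p = 2` with the tree's constants made explicit:
  `γ_cyc = cyclotomicGenerator 2 = 5` (`cyclotomicGenerator_two`, Mazur–Tate–Teitelbaum 1986 §I.13:
  `Γ = 1 + 4ℤ₂`), so clause 2 reads `[T¹]L · log₂ 5 = 𝓛₂(E) · [0]⁺_f` — the shape in which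
  [BDJ] Thm. 7.1 (`⟨·⟩_2 = χ_cyc ω_2⁻¹`, `ω_2` mod `4`) and Kobayashi Cor. 4.2 (`κ(γ)`) are read.
* `greenberg_stevens.coeff_one_eq_two` — the solved form `[T¹]L = (log₂ 5)⁻¹ · 𝓛₂(E) · [0]⁺_f`
  (`log₂ 5 ≠ 0` is the tree theorem
  `Literature.Barriers.BirchSwinnertonDyer.padicLog_cyclotomicGenerator_ne_zero`), i.e. the VALUE
  the cell's κ₁-valuation doors read (`X5/TwoAdicTargetsSplitGS.lean`, `kappaOne_of_greenbergStevens`).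
* `greenberg_stevens.order_eq_one_iff_two` — `ord_{T=0} L₂(E,T) = 1 ↔ [0]⁺_f ≠ 0` at `p = 2`, the
  `p = 2` instance BY NAME of
  `Literature.Barriers.BirchSwinnertonDyer.order_eq_one_iff_ratPlusSymbol_ne_zero_of_greenbergStevens`
  (which discharges `𝓛 ≠ 0` by `LInvariant_ne_zero_holds` and `log_p γ ≠ 0`).

Deliberately NOT here: any restatement of `greenberg_stevens`, of the weak form, or of the barrier
theorems (cited by name); any new hypothesis-carrying `def`; the Summits-side leaf
`MultUpperHalvesAtTwo.GreenbergStevensAtSplitTwo` (a planner/prover edit). When the in-place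
re-cite of `PAdicBSD.lean` lands, this module's §A becomes a duplicate of that docstring and may be
trimmed to a pointer at the same edit.
-/

noncomputable section

open scoped Classical MatrixGroups ModularForm

open CongruenceSubgroup WeierstrassCurve Literature.NumberTheory.EllipticCurves.ModularForms

namespace Literature.NumberTheory.EllipticCurves

section Two

variable (W : WeierstrassCurve ℚ) [W.IsElliptic]
  {N : ℕ} [NeZero N] {f : CuspForm (Gamma0 N) 2}

/-- **`greenberg_stevens` at `p = 2`, constants explicit.** Unfolding the named fact at `p = 2`
and rewriting `cyclotomicGenerator 2 = 5` (`cyclotomicGenerator_two`; Mazur–Tate–Teitelbaum 1986,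
§I.13: at `p = 2` the cyclotomic variable lives on `Γ = 1 + 4ℤ₂` with topological generator
`γ = 5`): for `E/ℚ` (model `W`) split multiplicative at `2` with Tate datum `Dq`, newform `f` and
`2`-adic `L`-function `L` (`IsSplitMultPAdicLFunctionOf f 2 L`), the fact says `L(0) = 0` and
`[T¹]L · log₂ 5 = 𝓛₂(E) · [0]⁺_f`. This is the reading under which Barrera Salazar–Dimitrov–Jorza,
JEMS 24 (2022) Thm. 7.1 (`⟨·⟩_2 = χ_cyc ω_2⁻¹`, `ω_2` the Teichmüller character mod `4`, p. 3444)
and Kobayashi 2006 Cor. 4.2 (first display, in `κ(γ)`) are cited for `p = 2` (referee C ROUND 405).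
Nothing is asserted: both sides are the named fact.
[cite: MazurTateTeitelbaum1986Invent, §I.13 (⟨x⟩ ∈ 1 + 4ℤ₂ if p = 2)]
[cite: BarreraDimitrovJorza2022, Thm. 7.1 (p = 2 convention p. 3444)] -/
theorem greenberg_stevens_two_iff :
    greenberg_stevens W 2 ↔
      ∀ (Dq : TateParameterData W 2) {N : ℕ} [NeZero N] {f : CuspForm (Gamma0 N) 2}
        (_hf : IsNewformOf W f) {L : PowerSeries ℚ_[2]} (_hL : IsSplitMultPAdicLFunctionOf f 2 L),
        PowerSeries.constantCoeff L = 0 ∧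
          PowerSeries.coeff 1 L * padicLog 2 5 = LInvariant Dq * (ratPlusSymbol f 0 : ℚ_[2]) := by
  simp only [greenberg_stevens, cyclotomicGenerator_two, Nat.cast_ofNat]

variable {W}

/-- **The solved form at `p = 2`:** under `greenberg_stevens W 2`,
`[T¹] L₂(E,T) = (log₂ 5)⁻¹ · 𝓛₂(E) · [0]⁺_f`, using `log₂ 5 ≠ 0`
(`Literature.Barriers.BirchSwinnertonDyer.padicLog_cyclotomicGenerator_ne_zero` at `p = 2`). This is
Kobayashi's Cor. 4.2 display `(d/dX) L_{p,γ}(E,X)|₀ = (log_p κ(γ))⁻¹ (log_p q_E/ord_p q_E) L(E,1)/Ω⁺_E`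
read at `p = 2`, `κ(γ) = 5` — the VALUE of the first Taylor coefficient, which the `2`-part doors of
the bsd-2adic cell consume (the weak form `Spiess2014.thm57_…` gives only its vanishing locus).
[cite: Kobayashi2006DocMath, Cor. 4.2 (p. 575), first display] -/
theorem greenberg_stevens.coeff_one_eq_two (h : greenberg_stevens W 2) (Dq : TateParameterData W 2)
    (hf : IsNewformOf W f) {L : PowerSeries ℚ_[2]} (hL : IsSplitMultPAdicLFunctionOf f 2 L) :
    PowerSeries.coeff 1 L = (padicLog 2 5)⁻¹ * (LInvariant Dq * (ratPlusSymbol f 0 : ℚ_[2])) := by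
  obtain ⟨-, h1⟩ := (greenberg_stevens_two_iff W).1 h Dq hf hL
  have h5 : padicLog 2 (5 : ℚ_[2]) ≠ 0 := by
    simpa [cyclotomicGenerator_two] using
      Literature.Barriers.BirchSwinnertonDyer.padicLog_cyclotomicGenerator_ne_zero 2
  rw [← h1, mul_comm (PowerSeries.coeff 1 L), ← mul_assoc, inv_mul_cancel₀ h5, one_mul]

/-- **`ord_{T=0} L₂(E,T) = 1 ↔ L(E,1)/Ω⁺_f ≠ 0` at a split multiplicative `2`, given only
`greenberg_stevens W 2`:** the `p = 2` instance, BY NAME, of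
`Literature.Barriers.BirchSwinnertonDyer.order_eq_one_iff_ratPlusSymbol_ne_zero_of_greenbergStevens`
(there `𝓛_p(E) ≠ 0` is the tree theorem `LInvariant_ne_zero_holds`, Barré-Sirieix–Diaz–Gramain–Philibert
1996, and `log_p γ_cyc ≠ 0` is `padicLog_cyclotomicGenerator_ne_zero`). Recorded here because the
`p = 2` case is the one whose print status changed (ROUND 405); nothing new is proved.
[cite: Kobayashi2006DocMath, Cor. 4.2 (p. 575)] [cite: MazurTateTeitelbaum1986Invent, §I.13, §I.15] -/
theorem greenberg_stevens.order_eq_one_iff_two (h : greenberg_stevens W 2)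
    (Dq : TateParameterData W 2) (hf : IsNewformOf W f) {L : PowerSeries ℚ_[2]}
    (hL : IsSplitMultPAdicLFunctionOf f 2 L) :
    L.order = 1 ↔ ratPlusSymbol f 0 ≠ 0 :=
  Literature.Barriers.BirchSwinnertonDyer.order_eq_one_iff_ratPlusSymbol_ne_zero_of_greenbergStevens
    W 2 h Dq hf hL

end Two

end Literature.NumberTheory.EllipticCurves

end
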